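import Summits.CriticalPhenomena.PercolationContinuityZ3.Theorems.PercNearOneGluingNoHeavyQuantFarGate3ChartCCertS
import HarnessLib

/-!
# QUANT lane R8, front "FAR beyond trees", layer one — THE DEGREE-THREE GATE AT THE OBSERVER, LI: box-certificate kernel v4-V — chart-C box COVERAGE
# (4-D k-d trees of certificates with `skip` leaves above the hyperbola `σu ≥ p₀`)

builds on p205010 (kernel theorem, internal audit signed; external expert review pending)

Support file (`--supports stmt-CriticalPhenomena-4575`), seat `prim-quant-p1` (gen 32); memo
`run/shared/lean/prim/quant/prim-quant-p1-g32/FOR-LEAD-GATE3-CHARTC.md`.  Mathlib-only on top of file L-d (`ChartC.sound`); standard axioms;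
no sorries.  GENERATED by `work/chartc/gen_cover.py` (pattern of file XLV `BoxCover`, one dimension up, no windows).

A chart-C DATA file lists a k-d tree (`ChartC.Tree`) over a rational box `B` in `(σ, u, r₁, r₂)`: internal nodes split one coordinate at a rational
threshold; a leaf is ONE certificate (file L-b) — `ChartC.covers p₀ fuel t B` checks (by `decide`) that it is `check`ed and that its integer
`(σ, u, w₁, w₂)`-box contains the leaf box (the `w₂`-range up to `1 − max r2lo r1lo`: boxes touching the diagonal cover the part `r₁ ≤ r₂`) — or a
`skip`, allowed only when `0 ≤ slo`, `0 ≤ ulo` and `p₀ ≤ slo·ulo`: every point of such a box has `p = σu ≥ p₀` and is the business of the `σ`-chart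
(files XLIV–XLV and their data).  `ChartC.tree_sound`: `covers p₀ fuel t B = true` implies that the chart-C system (hypothesis `hC` of
`Gate3.red8_of_chartC`, file XLVI) is infeasible at every `(σ, u, r₁, r₂) ∈ B` with `σu < p₀`, `0 < σ`, `0 < u`, `σu ≤ 1`, `0 ≤ r₁ ≤ r₂ < 1` — packaged as
`ChartC.BoxOKC p₀ B` / `ChartC.BoxOKCR` (real bounds; the shape of every region theorem of the chart-C data files).
[this work].
-/

noncomputable section

namespace Summit.CriticalPhenomena.PercolationContinuityZ3.Theorems

namespace Quant

namespace ChartC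

/-- A rational parameter box `[slo, shi] × [ulo, uhi] × [r1lo, r1hi] × [r2lo, r2hi]` in `(σ, u, r₁, r₂)`. -/
structure QBox4 where
  slo : ℚ
  shi : ℚ
  ulo : ℚ
  uhi : ℚ
  r1lo : ℚ
  r1hi : ℚ
  r2lo : ℚ
  r2hi : ℚ

/-- Replace the upper (`upper = true`) or lower end of axis `ax` (0 = σ, 1 = u, 2 = r₁, 3 = r₂) by `t`. -/
def QBox4.cut (B : QBox4) (ax : ℕ) (t : ℚ) (upper : Bool) : QBox4 :=
  match ax, upper with
  | 0, true => { B with shi := t }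
  | 0, false => { B with slo := t }
  | 1, true => { B with uhi := t }
  | 1, false => { B with ulo := t }
  | 2, true => { B with r1hi := t }
  | 2, false => { B with r1lo := t }
  | _, true => { B with r2hi := t }
  | _, false => { B with r2lo := t }

/-- k-d tree of chart-C certificates; `skip` marks a sub-box lying on or above the hyperbola `σu = p₀`. -/
inductive Tree where
  | leaf (c : Cert) : Tree
  | skip : Tree
  | node (ax : ℕ) (t : ℚ) (tlo thi : Tree) : Tree

/-- The certificate's integer `(σ, u, w₁, w₂)`-box contains the part `r₁ ≤ r₂` of the rational box `B`. -/
def certContains (c : Cert) (B : QBox4) : Bool :=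
  decide (0 < c.D) && decide ((c.S0 : ℚ) ≤ c.D * B.slo) && decide ((c.D : ℚ) * B.shi ≤ c.S1) &&
    decide ((c.T0 : ℚ) ≤ c.D * B.ulo) && decide ((c.D : ℚ) * B.uhi ≤ c.T1) &&
    decide ((c.U0 : ℚ) ≤ c.D * (1 - B.r1hi)) && decide ((c.D : ℚ) * (1 - B.r1lo) ≤ c.U1) &&
    decide ((c.V0 : ℚ) ≤ c.D * (1 - B.r2hi)) && decide ((c.D : ℚ) * (1 - max B.r2lo B.r1lo) ≤ c.V1)

/-- The tree `t` covers the box `B` below the hyperbola `σu = p₀` (fuel recursion, for cheap kernel evaluation). -/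
def covers (p₀ : ℚ) : ℕ → Tree → QBox4 → Bool
  | 0, _, _ => false
  | _ + 1, Tree.leaf c, B => check c && certContains c B
  | _ + 1, Tree.skip, B => decide (0 ≤ B.slo ∧ 0 ≤ B.ulo ∧ p₀ ≤ B.slo * B.ulo)
  | fuel + 1, Tree.node ax t tlo thi, B => covers p₀ fuel tlo (B.cut ax t true) && covers p₀ fuel thi (B.cut ax t false)

set_option maxHeartbeats 800000 in
/-- A checked certificate containing the point refutes the chart-C system there (restatement of `ChartC.sound` with the box hypotheses read
off `certContains`). -/
theorem cert_apply (c : Cert) (B : QBox4) (hchk : check c = true) (hcont : certContains c B = true) (σ u r₁ r₂ : ℝ)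
    (hslo : (B.slo : ℝ) ≤ σ) (hshi : σ ≤ B.shi) (hulo : (B.ulo : ℝ) ≤ u) (huhi : u ≤ B.uhi)
    (h1lo : (B.r1lo : ℝ) ≤ r₁) (h1hi : r₁ ≤ B.r1hi) (h2lo : (B.r2lo : ℝ) ≤ r₂) (h2hi : r₂ ≤ B.r2hi)
    (hσ0 : 0 < σ) (hu0 : 0 < u) (hσu : σ * u ≤ 1) (hr10 : 0 ≤ r₁) (hr12 : r₁ ≤ r₂) (hr2 : r₂ < 1) :
    ∀ (a0 a1 A2 B1 B2 c0 c1 D : ℝ), 0 ≤ a0 → 0 ≤ a1 → 0 ≤ A2 → 0 ≤ B1 → 0 ≤ B2 → 0 ≤ c0 → 0 ≤ c1 → 0 ≤ D →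
    B1 * (u * B2 + (c0 + c1)) ≤ σ * D * (a0 + a1 + σ * u * A2) →
    B2 * (u * B1 + (c0 + c1)) ≤ σ * D * (a0 + a1 + σ * u * A2) →
    (c0 + c1) * (B1 + B2) ≤ σ * D * (a0 + a1 + σ * u * A2) →
    B1 * (a1 + σ * u * A2 + c1 + σ * u * D) ≤ σ * D * (a0 + u * B1 + u * B2 + c0) →
    B2 * (a1 + σ * u * A2 + c1 + σ * u * D) ≤ σ * D * (a0 + u * B1 + u * B2 + c0) →
    c0 * (a1 + σ * u * A2 + c1 + σ * u * D) ≤ (c1 + σ * u * D) * (a0 + u * B1 + u * B2 + c0) →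
    0 < ((1 - r₁) * (1 - r₂)) * (a0 + c0) - (1 - σ * u) * A2 - (1 - σ * u) * ((1 - r₁) * (1 - r₂)) * D →
    0 < (1 - σ * u) * (1 - r₁) * B1 - σ * (r₂ * (1 - r₁)) * a0 - σ * (1 - r₁) * a1 - σ * (1 - σ * u * r₁) * A2 - (1 - (1 - σ * u) * (1 - r₂)) * (1 - r₁) * B2 - σ * ((1 - r₁) * (1 - r₂)) * c1 →
    0 < (1 - σ * u) * (1 - r₂) * B2 - σ * (r₁ * (1 - r₂)) * a0 - σ * (1 - r₂) * a1 - σ * (1 - σ * u * r₂) * A2 - (1 - (1 - σ * u) * (1 - r₁)) * (1 - r₂) * B1 - σ * ((1 - r₁) * (1 - r₂)) * c1 →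
    0 < (1 - σ * u * max r₁ r₂ - σ * (1 - max r₁ r₂)) * a1 + (1 - σ * u * (r₁ + r₂ * (1 - r₁)) - σ * ((1 - r₁) * (1 - r₂))) * c1 - σ * (r₁ + r₂ * (1 - r₁) - max r₁ r₂) * a0 - ((1 - (1 - σ * u) * (1 - r₁)) * (1 - r₂)) * B1 - ((1 - (1 - σ * u) * (1 - r₂)) * (1 - r₁)) * B2 →
    0 < (σ * u * (1 + r₁ + r₂) + σ * max r₁ r₂ - 2) * a0 + (σ * u * (1 + r₁ + r₂) + σ * max r₁ r₂ - σ * u * max r₁ r₂ - 1) * a1 + σ * (σ * u * u * (1 + r₁ + r₂) + 1 - 2 * u) * A2 + ((1 - (1 - σ * u) * (1 - r₁)) * (u + r₂ * (1 + u)) - u) * B1 + ((1 - (1 - σ * u) * (1 - r₂)) * (u + r₁ * (1 + u)) - u) * B2 + (σ * u + (σ + 2 * (σ * u)) * (r₁ + r₂ * (1 - r₁)) - 2) * c0 + (σ * u + (σ + σ * u) * (r₁ + r₂ * (1 - r₁)) - 1) * c1 + (σ + σ * u - σ * u * ((1 - σ * u) * ((1 - r₁) * (1 - r₂)))) * D 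→
    False := by
  simp only [certContains, Bool.and_eq_true, decide_eq_true_eq] at hcont
  obtain ⟨⟨⟨⟨⟨⟨⟨⟨hD, hS0⟩, hS1⟩, hT0⟩, hT1⟩, hU0⟩, hU1⟩, hV0⟩, hV1⟩ := hcont
  have hDpos : (0 : ℝ) < c.D := by exact_mod_cast hD
  have hS0' : ((c.S0 : ℚ) : ℝ) ≤ ((c.D : ℚ) : ℝ) * (B.slo : ℝ) := by exact_mod_cast hS0
  have hS1' : ((c.D : ℚ) : ℝ) * (B.shi : ℝ) ≤ ((c.S1 : ℚ) : ℝ) := by exact_mod_cast hS1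
  have hT0' : ((c.T0 : ℚ) : ℝ) ≤ ((c.D : ℚ) : ℝ) * (B.ulo : ℝ) := by exact_mod_cast hT0
  have hT1' : ((c.D : ℚ) : ℝ) * (B.uhi : ℝ) ≤ ((c.T1 : ℚ) : ℝ) := by exact_mod_cast hT1
  have hU0' : ((c.U0 : ℚ) : ℝ) ≤ ((c.D : ℚ) : ℝ) * (1 - (B.r1hi : ℝ)) := by exact_mod_cast hU0
  have hU1' : ((c.D : ℚ) : ℝ) * (1 - (B.r1lo : ℝ)) ≤ ((c.U1 : ℚ) : ℝ) := by exact_mod_cast hU1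
  have hV0' : ((c.V0 : ℚ) : ℝ) ≤ ((c.D : ℚ) : ℝ) * (1 - (B.r2hi : ℝ)) := by exact_mod_cast hV0
  have hV1' : ((c.D : ℚ) : ℝ) * (1 - ((max B.r2lo B.r1lo : ℚ) : ℝ)) ≤ ((c.V1 : ℚ) : ℝ) := by exact_mod_cast hV1
  have hmax : ((max B.r2lo B.r1lo : ℚ) : ℝ) ≤ r₂ := by
    rw [Rat.cast_max]; exact max_le h2lo (h1lo.trans hr12)
  simp only [Rat.cast_natCast] at hS0' hS1' hT0' hT1' hU0' hU1' hV0' hV1'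
  have hD0 := hDpos.le
  exact sound c hchk σ u r₁ r₂ hσ0 hu0 hσu hr10 hr12 hr2
    (hS0'.trans (mul_le_mul_of_nonneg_left hslo hD0)) (le_trans (mul_le_mul_of_nonneg_left hshi hD0) hS1')
    (hT0'.trans (mul_le_mul_of_nonneg_left hulo hD0)) (le_trans (mul_le_mul_of_nonneg_left huhi hD0) hT1')
    (hU0'.trans (mul_le_mul_of_nonneg_left (by linarith) hD0)) (le_trans (mul_le_mul_of_nonneg_left (by linarith) hD0) hU1')
    (hV0'.trans (mul_le_mul_of_nonneg_left (by linarith) hD0)) (le_trans (mul_le_mul_of_nonneg_left (by linarith) hD0) hV1')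

/-- **Coverage theorem.** -/
theorem tree_sound (p₀ : ℚ) : ∀ (fuel : ℕ) (t : Tree) (B : QBox4), covers p₀ fuel t B = true → ∀ (σ u r₁ r₂ : ℝ),
    (B.slo : ℝ) ≤ σ → σ ≤ B.shi → (B.ulo : ℝ) ≤ u → u ≤ B.uhi → (B.r1lo : ℝ) ≤ r₁ → r₁ ≤ B.r1hi → (B.r2lo : ℝ) ≤ r₂ → r₂ ≤ B.r2hi →
    σ * u < p₀ → 0 < σ → 0 < u → σ * u ≤ 1 → 0 ≤ r₁ → r₁ ≤ r₂ → r₂ < 1 →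
    ∀ (a0 a1 A2 B1 B2 c0 c1 D : ℝ), 0 ≤ a0 → 0 ≤ a1 → 0 ≤ A2 → 0 ≤ B1 → 0 ≤ B2 → 0 ≤ c0 → 0 ≤ c1 → 0 ≤ D →
    B1 * (u * B2 + (c0 + c1)) ≤ σ * D * (a0 + a1 + σ * u * A2) →
    B2 * (u * B1 + (c0 + c1)) ≤ σ * D * (a0 + a1 + σ * u * A2) →
    (c0 + c1) * (B1 + B2) ≤ σ * D * (a0 + a1 + σ * u * A2) →
    B1 * (a1 + σ * u * A2 + c1 + σ * u * D) ≤ σ * D * (a0 + u * B1 + u * B2 + c0) →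
    B2 * (a1 + σ * u * A2 + c1 + σ * u * D) ≤ σ * D * (a0 + u * B1 + u * B2 + c0) →
    c0 * (a1 + σ * u * A2 + c1 + σ * u * D) ≤ (c1 + σ * u * D) * (a0 + u * B1 + u * B2 + c0) →
    0 < ((1 - r₁) * (1 - r₂)) * (a0 + c0) - (1 - σ * u) * A2 - (1 - σ * u) * ((1 - r₁) * (1 - r₂)) * D →
    0 < (1 - σ * u) * (1 - r₁) * B1 - σ * (r₂ * (1 - r₁)) * a0 - σ * (1 - r₁) * a1 - σ * (1 - σ * u * r₁) * A2 - (1 - (1 - σ * u) * (1 - r₂)) * (1 - r₁) * B2 - σ * ((1 - r₁) * (1 - r₂)) * c1 →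
    0 < (1 - σ * u) * (1 - r₂) * B2 - σ * (r₁ * (1 - r₂)) * a0 - σ * (1 - r₂) * a1 - σ * (1 - σ * u * r₂) * A2 - (1 - (1 - σ * u) * (1 - r₁)) * (1 - r₂) * B1 - σ * ((1 - r₁) * (1 - r₂)) * c1 →
    0 < (1 - σ * u * max r₁ r₂ - σ * (1 - max r₁ r₂)) * a1 + (1 - σ * u * (r₁ + r₂ * (1 - r₁)) - σ * ((1 - r₁) * (1 - r₂))) * c1 - σ * (r₁ + r₂ * (1 - r₁) - max r₁ r₂) * a0 - ((1 - (1 - σ * u) * (1 - r₁)) * (1 - r₂)) * B1 - ((1 - (1 - σ * u) * (1 - r₂)) * (1 - r₁)) * B2 →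
    0 < (σ * u * (1 + r₁ + r₂) + σ * max r₁ r₂ - 2) * a0 + (σ * u * (1 + r₁ + r₂) + σ * max r₁ r₂ - σ * u * max r₁ r₂ - 1) * a1 + σ * (σ * u * u * (1 + r₁ + r₂) + 1 - 2 * u) * A2 + ((1 - (1 - σ * u) * (1 - r₁)) * (u + r₂ * (1 + u)) - u) * B1 + ((1 - (1 - σ * u) * (1 - r₂)) * (u + r₁ * (1 + u)) - u) * B2 + (σ * u + (σ + 2 * (σ * u)) * (r₁ + r₂ * (1 - r₁)) - 2) * c0 + (σ * u + (σ + σ * u) * (r₁ + r₂ * (1 - r₁)) - 1) * c1 + (σ + σ * u - σ * u * ((1 - σ * u) * ((1 - r₁) * (1 - r₂)))) * D →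
    False
  | 0, t, B, hcov => by simp [covers] at hcov
  | fuel + 1, Tree.leaf c, B, hcov => by
    intro σ u r₁ r₂ hslo hshi hulo huhi h1lo h1hi h2lo h2hi hp hσ0 hu0 hσu hr10 hr12 hr2
    simp only [covers, Bool.and_eq_true] at hcov
    exact cert_apply c B hcov.1 hcov.2 σ u r₁ r₂ hslo hshi hulo huhi h1lo h1hi h2lo h2hi hσ0 hu0 hσu hr10 hr12 hr2
  | fuel + 1, Tree.skip, B, hcov => by
    intro σ u r₁ r₂ hslo hshi hulo huhi h1lo h1hi h2lo h2hi hp hσ0 hu0 hσu hr10 hr12 hr2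
    exfalso
    simp only [covers, decide_eq_true_eq] at hcov
    obtain ⟨hs, hu, hpp⟩ := hcov
    have hs' : (0 : ℝ) ≤ (B.slo : ℝ) := by exact_mod_cast hs
    have hu' : (0 : ℝ) ≤ (B.ulo : ℝ) := by exact_mod_cast hu
    have hpp' : ((p₀ : ℚ) : ℝ) ≤ (B.slo : ℝ) * (B.ulo : ℝ) := by exact_mod_cast hpp
    have hm : (B.slo : ℝ) * (B.ulo : ℝ) ≤ σ * u := mul_le_mul hslo hulo hu' hσ0.le
    linarith
  | fuel + 1, Tree.node ax t tlo thi, B, hcov => by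
    intro σ u r₁ r₂ hslo hshi hulo huhi h1lo h1hi h2lo h2hi hp hσ0 hu0 hσu hr10 hr12 hr2
    simp only [covers, Bool.and_eq_true] at hcov
    obtain ⟨hclo, hchi⟩ := hcov
    have ihlo := tree_sound p₀ fuel tlo (B.cut ax t true) hclo σ u r₁ r₂
    have ihhi := tree_sound p₀ fuel thi (B.cut ax t false) hchi σ u r₁ r₂
    rcases Nat.lt_or_ge ax 1 with hax | hax
    · have hax0 : ax = 0 := by omega
      subst hax0
      rcases le_total σ (t : ℝ) with hle | hge
      · exact ihlo (by simpa [QBox4.cut] using hslo) (by simpa [QBox4.cut] using hle) (by simpa [QBox4.cut] using hulo)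
          (by simpa [QBox4.cut] using huhi) (by simpa [QBox4.cut] using h1lo) (by simpa [QBox4.cut] using h1hi)
          (by simpa [QBox4.cut] using h2lo) (by simpa [QBox4.cut] using h2hi) hp hσ0 hu0 hσu hr10 hr12 hr2
      · exact ihhi (by simpa [QBox4.cut] using hge) (by simpa [QBox4.cut] using hshi) (by simpa [QBox4.cut] using hulo)
          (by simpa [QBox4.cut] using huhi) (by simpa [QBox4.cut] using h1lo) (by simpa [QBox4.cut] using h1hi)
          (by simpa [QBox4.cut] using h2lo) (by simpa [QBox4.cut] using h2hi) hp hσ0 hu0 hσu hr10 hr12 hr2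
    · rcases Nat.lt_or_ge ax 2 with hax1 | hax2
      · have hax1' : ax = 1 := by omega
        subst hax1'
        rcases le_total u (t : ℝ) with hle | hge
        · exact ihlo (by simpa [QBox4.cut] using hslo) (by simpa [QBox4.cut] using hshi) (by simpa [QBox4.cut] using hulo)
            (by simpa [QBox4.cut] using hle) (by simpa [QBox4.cut] using h1lo) (by simpa [QBox4.cut] using h1hi)
            (by simpa [QBox4.cut] using h2lo) (by simpa [QBox4.cut] using h2hi) hp hσ0 hu0 hσu hr10 hr12 hr2
        · exact ihhi (by simpa [QBox4.cut] using hslo) (by simpa [QBox4.cut] using hshi) (by simpa [QBox4.cut] using hge)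
            (by simpa [QBox4.cut] using huhi) (by simpa [QBox4.cut] using h1lo) (by simpa [QBox4.cut] using h1hi)
            (by simpa [QBox4.cut] using h2lo) (by simpa [QBox4.cut] using h2hi) hp hσ0 hu0 hσu hr10 hr12 hr2
      · rcases Nat.lt_or_ge ax 3 with hax2' | hax3
        · have hax2'' : ax = 2 := by omega
          subst hax2''
          rcases le_total r₁ (t : ℝ) with hle | hge
          · exact ihlo (by simpa [QBox4.cut] using hslo) (by simpa [QBox4.cut] using hshi) (by simpa [QBox4.cut] using hulo)
              (by simpa [QBox4.cut] using huhi) (by simpa [QBox4.cut] using h1lo) (by simpa [QBox4.cut] using hle)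
              (by simpa [QBox4.cut] using h2lo) (by simpa [QBox4.cut] using h2hi) hp hσ0 hu0 hσu hr10 hr12 hr2
          · exact ihhi (by simpa [QBox4.cut] using hslo) (by simpa [QBox4.cut] using hshi) (by simpa [QBox4.cut] using hulo)
              (by simpa [QBox4.cut] using huhi) (by simpa [QBox4.cut] using hge) (by simpa [QBox4.cut] using h1hi)
              (by simpa [QBox4.cut] using h2lo) (by simpa [QBox4.cut] using h2hi) hp hσ0 hu0 hσu hr10 hr12 hr2
        · obtain ⟨m, hm⟩ : ∃ m, ax = m + 3 := ⟨ax - 3, by omega⟩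
          subst hm
          rcases le_total r₂ (t : ℝ) with hle | hge
          · exact ihlo (by simpa [QBox4.cut] using hslo) (by simpa [QBox4.cut] using hshi) (by simpa [QBox4.cut] using hulo)
              (by simpa [QBox4.cut] using huhi) (by simpa [QBox4.cut] using h1lo) (by simpa [QBox4.cut] using h1hi)
              (by simpa [QBox4.cut] using h2lo) (by simpa [QBox4.cut] using hle) hp hσ0 hu0 hσu hr10 hr12 hr2
          · exact ihhi (by simpa [QBox4.cut] using hslo) (by simpa [QBox4.cut] using hshi) (by simpa [QBox4.cut] using hulo)
              (by simpa [QBox4.cut] using huhi) (by simpa [QBox4.cut] using h1lo) (by simpa [QBox4.cut] using h1hi)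
              (by simpa [QBox4.cut] using hge) (by simpa [QBox4.cut] using h2hi) hp hσ0 hu0 hσu hr10 hr12 hr2

/-- The chart-C system is infeasible on the part `σu < p₀`, `0 < σ`, `0 < u`, `σu ≤ 1`, `0 ≤ r₁ ≤ r₂ < 1` of the rational box `B` (the shape of
every region / leaf theorem of the chart-C data files). -/
def BoxOKC (p₀ : ℚ) (B : QBox4) : Prop := ∀ (σ u r₁ r₂ : ℝ),
    (B.slo : ℝ) ≤ σ → σ ≤ B.shi → (B.ulo : ℝ) ≤ u → u ≤ B.uhi → (B.r1lo : ℝ) ≤ r₁ → r₁ ≤ B.r1hi → (B.r2lo : ℝ) ≤ r₂ → r₂ ≤ B.r2hi →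
    σ * u < p₀ → 0 < σ → 0 < u → σ * u ≤ 1 → 0 ≤ r₁ → r₁ ≤ r₂ → r₂ < 1 →
    ∀ (a0 a1 A2 B1 B2 c0 c1 D : ℝ), 0 ≤ a0 → 0 ≤ a1 → 0 ≤ A2 → 0 ≤ B1 → 0 ≤ B2 → 0 ≤ c0 → 0 ≤ c1 → 0 ≤ D →
    B1 * (u * B2 + (c0 + c1)) ≤ σ * D * (a0 + a1 + σ * u * A2) →
    B2 * (u * B1 + (c0 + c1)) ≤ σ * D * (a0 + a1 + σ * u * A2) →
    (c0 + c1) * (B1 + B2) ≤ σ * D * (a0 + a1 + σ * u * A2) →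
    B1 * (a1 + σ * u * A2 + c1 + σ * u * D) ≤ σ * D * (a0 + u * B1 + u * B2 + c0) →
    B2 * (a1 + σ * u * A2 + c1 + σ * u * D) ≤ σ * D * (a0 + u * B1 + u * B2 + c0) →
    c0 * (a1 + σ * u * A2 + c1 + σ * u * D) ≤ (c1 + σ * u * D) * (a0 + u * B1 + u * B2 + c0) →
    0 < ((1 - r₁) * (1 - r₂)) * (a0 + c0) - (1 - σ * u) * A2 - (1 - σ * u) * ((1 - r₁) * (1 - r₂)) * D →
    0 < (1 - σ * u) * (1 - r₁) * B1 - σ * (r₂ * (1 - r₁)) * a0 - σ * (1 - r₁) * a1 - σ * (1 - σ * u * r₁) * A2 - (1 - (1 - σ * u) * (1 - r₂)) * (1 - r₁) * B2 - σ * ((1 - r₁) * (1 - r₂)) * c1 →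
    0 < (1 - σ * u) * (1 - r₂) * B2 - σ * (r₁ * (1 - r₂)) * a0 - σ * (1 - r₂) * a1 - σ * (1 - σ * u * r₂) * A2 - (1 - (1 - σ * u) * (1 - r₁)) * (1 - r₂) * B1 - σ * ((1 - r₁) * (1 - r₂)) * c1 →
    0 < (1 - σ * u * max r₁ r₂ - σ * (1 - max r₁ r₂)) * a1 + (1 - σ * u * (r₁ + r₂ * (1 - r₁)) - σ * ((1 - r₁) * (1 - r₂))) * c1 - σ * (r₁ + r₂ * (1 - r₁) - max r₁ r₂) * a0 - ((1 - (1 - σ * u) * (1 - r₁)) * (1 - r₂)) * B1 - ((1 - (1 - σ * u) * (1 - r₂)) * (1 - r₁)) * B2 →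
    0 < (σ * u * (1 + r₁ + r₂) + σ * max r₁ r₂ - 2) * a0 + (σ * u * (1 + r₁ + r₂) + σ * max r₁ r₂ - σ * u * max r₁ r₂ - 1) * a1 + σ * (σ * u * u * (1 + r₁ + r₂) + 1 - 2 * u) * A2 + ((1 - (1 - σ * u) * (1 - r₁)) * (u + r₂ * (1 + u)) - u) * B1 + ((1 - (1 - σ * u) * (1 - r₂)) * (u + r₁ * (1 + u)) - u) * B2 + (σ * u + (σ + 2 * (σ * u)) * (r₁ + r₂ * (1 - r₁)) - 2) * c0 + (σ * u + (σ + σ * u) * (r₁ + r₂ * (1 - r₁)) - 1) * c1 + (σ + σ * u - σ * u * ((1 - σ * u) * ((1 - r₁) * (1 - r₂)))) * D →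
    False

/-- A covered box satisfies `BoxOKC`. -/
theorem boxOKC_of_covers (p₀ : ℚ) (fuel : ℕ) (t : Tree) (B : QBox4) (h : covers p₀ fuel t B = true) : BoxOKC p₀ B :=
  tree_sound p₀ fuel t B h

/-- The same statement with `p₀` and the eight box bounds as real parameters (the shape used by the dispatch theorems). -/
def BoxOKCR (p₀ slo shi ulo uhi r1lo r1hi r2lo r2hi : ℝ) : Prop := ∀ (σ u r₁ r₂ : ℝ),
    slo ≤ σ → σ ≤ shi → ulo ≤ u → u ≤ uhi → r1lo ≤ r₁ → r₁ ≤ r1hi → r2lo ≤ r₂ → r₂ ≤ r2hi →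
    σ * u < p₀ → 0 < σ → 0 < u → σ * u ≤ 1 → 0 ≤ r₁ → r₁ ≤ r₂ → r₂ < 1 →
    ∀ (a0 a1 A2 B1 B2 c0 c1 D : ℝ), 0 ≤ a0 → 0 ≤ a1 → 0 ≤ A2 → 0 ≤ B1 → 0 ≤ B2 → 0 ≤ c0 → 0 ≤ c1 → 0 ≤ D →
    B1 * (u * B2 + (c0 + c1)) ≤ σ * D * (a0 + a1 + σ * u * A2) →
    B2 * (u * B1 + (c0 + c1)) ≤ σ * D * (a0 + a1 + σ * u * A2) →
    (c0 + c1) * (B1 + B2) ≤ σ * D * (a0 + a1 + σ * u * A2) →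
    B1 * (a1 + σ * u * A2 + c1 + σ * u * D) ≤ σ * D * (a0 + u * B1 + u * B2 + c0) →
    B2 * (a1 + σ * u * A2 + c1 + σ * u * D) ≤ σ * D * (a0 + u * B1 + u * B2 + c0) →
    c0 * (a1 + σ * u * A2 + c1 + σ * u * D) ≤ (c1 + σ * u * D) * (a0 + u * B1 + u * B2 + c0) →
    0 < ((1 - r₁) * (1 - r₂)) * (a0 + c0) - (1 - σ * u) * A2 - (1 - σ * u) * ((1 - r₁) * (1 - r₂)) * D →
    0 < (1 - σ * u) * (1 - r₁) * B1 - σ * (r₂ * (1 - r₁)) * a0 - σ * (1 - r₁) * a1 - σ * (1 - σ * u * r₁) * A2 - (1 - (1 - σ * u) * (1 - r₂)) * (1 - r₁) * B2 - σ * ((1 - r₁) * (1 - r₂)) * c1 →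
    0 < (1 - σ * u) * (1 - r₂) * B2 - σ * (r₁ * (1 - r₂)) * a0 - σ * (1 - r₂) * a1 - σ * (1 - σ * u * r₂) * A2 - (1 - (1 - σ * u) * (1 - r₁)) * (1 - r₂) * B1 - σ * ((1 - r₁) * (1 - r₂)) * c1 →
    0 < (1 - σ * u * max r₁ r₂ - σ * (1 - max r₁ r₂)) * a1 + (1 - σ * u * (r₁ + r₂ * (1 - r₁)) - σ * ((1 - r₁) * (1 - r₂))) * c1 - σ * (r₁ + r₂ * (1 - r₁) - max r₁ r₂) * a0 - ((1 - (1 - σ * u) * (1 - r₁)) * (1 - r₂)) * B1 - ((1 - (1 - σ * u) * (1 - r₂)) * (1 - r₁)) * B2 →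
    0 < (σ * u * (1 + r₁ + r₂) + σ * max r₁ r₂ - 2) * a0 + (σ * u * (1 + r₁ + r₂) + σ * max r₁ r₂ - σ * u * max r₁ r₂ - 1) * a1 + σ * (σ * u * u * (1 + r₁ + r₂) + 1 - 2 * u) * A2 + ((1 - (1 - σ * u) * (1 - r₁)) * (u + r₂ * (1 + u)) - u) * B1 + ((1 - (1 - σ * u) * (1 - r₂)) * (u + r₁ * (1 + u)) - u) * B2 + (σ * u + (σ + 2 * (σ * u)) * (r₁ + r₂ * (1 - r₁)) - 2) * c0 + (σ * u + (σ + σ * u) * (r₁ + r₂ * (1 - r₁)) - 1) * c1 + (σ + σ * u - σ * u * ((1 - σ * u) * ((1 - r₁) * (1 - r₂)))) * D →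
    False

/-- `BoxOKC p₀ B` is `BoxOKCR` of the cast bounds. -/
theorem boxOKCR_of_boxOKC (p₀ : ℚ) (B : QBox4) (h : BoxOKC p₀ B) : BoxOKCR (p₀ : ℝ) B.slo B.shi B.ulo B.uhi B.r1lo B.r1hi B.r2lo B.r2hi :=
  h

end ChartC

end Quant

end Summit.CriticalPhenomena.PercolationContinuityZ3.Theorems
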